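import Summits.SmoothPoincare4.SmoothPoincare4.Theses.CongruenceShadows
import Summits.SmoothPoincare4.SmoothPoincare4.Theorems.NilpotentShadowsStandard.Negative.Shape
import Literature.Algebra.Lie.SurfaceLieAlgebra
import HarnessLib.Audit

/-!
# Line `heegaard-absorption` — crux `CongruenceShadows.NilpotentShadowsStandard` (stmt-SmoothPoincare4-14594)

Skeleton (crux-plan, round 1, planner-cruxplan-stmt-SmoothPoincare4-14594-heegaard-absorption-0, 2026-08-16).

THE CRUX. For every `(3+3m, m+1)` group trisection `K` of the trivial group and every `c`, some automorphism
`ψ` of `S = S_{3+3m}` carries `Nᵢ·γ_{c+2}S` onto `Kᵢ·γ_{c+2}S` for `i = 0,1,2` simultaneously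
(`N = s4Kernels.stabilizeIter m`, `γ_{c+2}S = (⊤).lowerCentralSeries (c+1)`).

THE LINE (idea card `Ideas/heegaard-absorption.md`, sharpened by TRIAGE-r1-1/2/3). Induct on the level `c`
(the contrapositive of the disprover's `counterexample_shape`: bad levels are an up-set). Level `0` is the route's
support item `AbelianShadowStandard` (stmt-SmoothPoincare4-14599, hypothesis BY NAME). The step `c-1 → c`
(`c ≥ 1`) is cut into a DICTIONARY and a LEVER:

* dictionary `stub_torsorStep`: over a level-`(c-1)`-standard triple, the level-`c` position of each genuine
  kernel `Kᵢ` is a datum `dᵢ : Cᵢ → 𝔰_{c+1}` (cut letters of the coordinate cut system `Cᵢ = s4CutSystem m i`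
  into the degree-`c+1` piece of the surface Lie ring `𝔰 = 𝔰_{3+3m}(ℤ) = gr S`, Labute), read off through
  Labute's `θ_c : γ_{c+1} → 𝔰_{c+1}`; genuineness of `Kᵢ` (`S/Kᵢ ≅ F_g`) gives the `ζ`-condition (b), the pair
  axiom (`S/KᵢKⱼ ≅ F_{m+1}`) the linear compatibility (c), and an automorphism `ψ` trivial mod `γ_{c+1}`
  translates the datum by the restriction of its Johnson image `τ_c(ψ) ∈ Der_c(𝔰)`; so the step follows from
  REACH_c: every admissible data triple is `θ_c(ψ(x)x⁻¹) mod I_{Cᵢ}` for one such `ψ`;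
* `stub_jointSurjectivity` (pure Lie, letter-content bookkeeping): admissible triples are restrictions
  `(D(x) mod I_{Cᵢ})` of ONE derivation `D ∈ Der_c(𝔰)`;
* THE LEVER, Heegaard absorption `Der_c = 𝔤_c + (𝔷₀∩𝔷₁∩𝔷₂)_c` (`𝔤_c` the Johnson image, `𝔷ᵢ` the stabiliser of
  the cut ideal `I_{Cᵢ}` = kernel of the `i`-th restriction), split exactly as the triage asked
  ("Absorption_c alone ⟺ JS_c", rank part + integral part):
  `stub_rationalAbsorption` — `Der_c ⊗ ℚ = ⟨Der_1⟩_c ⊗ ℚ + tri-stabiliser ⊗ ℚ` (the card's verified lattice identity: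
  g = 3, c ≤ 5 and g = 6, c ≤ 3 by the ideator; c ≤ 8 at g = 3 by TRIAGE-r1-1 (C2)/r1-2; a finite exact rank
  computation per `(m,c)`), `stub_johnsonBrackets` — iterated brackets of degree-1 derivations ARE Johnson
  (Johnson 1980: `τ₁` onto `Λ³H = Der₁` for `g ≥ 3`; Andreadakis: `τ` is a morphism of graded Lie rings),
  `stub_saturation` — the integral residue: `Der_c/(𝔤_c + 𝔷₀₁₂,c)` is torsion-free (true at `c ≤ 2` by
  TRIAGE-r1-1 (C1): index 1 at g = 3, 6, 9 with `im τ₂ = ker Tr^as`; OPEN from `(g,c) = (3,3)` — the bet);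
* `stub_labute` — Labute 1970 (`gr S_g ≅ 𝔰_g(ℤ)`), the Literature named fact the dictionary is written in.

`NilpotentShadowsStandard_of` composes them (kernel-checked, no `sorry` outside the six `stub_*`): at each level
`reach_of` turns rational absorption + bracket realisation + saturation + joint surjectivity into REACH_c, and
`stub_torsorStep` climbs one level.

WHY `⟨Der₁⟩` AND NOT "THE JOHNSON IMAGE" IN THE LEVER. Integrally `⟨Der₁⟩₂ = [Λ³H, Λ³H] ⊊ im τ₂` (the squares
`τ₂(T_γ)`, `γ` a bounding curve, are not brackets: Morita, Yokomizo; Faes arXiv:2010.16268 Thm 2.4), and a square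
supported in one handlebody complement moves that shadow, so "Der₂ = ⟨Der₁⟩₂ + tri-stabiliser" is FALSE over `ℤ`
already at `(g,c) = (3,2)` while true over `ℚ` (Hain: `im τ ⊗ ℚ` is generated in degree 1). Hence the rank
statement is filed with `⟨Der₁⟩` (typable over the tree, decidable) and the integral statement through the group
(`stub_saturation`), where `im τ₂ ∋` squares.

Disproof.lean / landed `Negative/*` (imported above so this scratch check sees them) are honoured:
`nilpotentShadowsStandard_false_without_trisection` — `stub_torsorStep` keeps `IsGroupTrisection` (it is used
three times: `free_quotient` for the `ζ`-condition and no-hidden-depth, `free_pairQuotient` for (c), and — only at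
level 0, inside `AbelianShadowStandard` — `triple`), consistent with `anyGroup_false_of_…` (PUnit enters at
`c = 0` only); the induction is `counterexample_shape`/`shadow_mono` read forwards; no stub is an instance of a
landed Negative lemma (none concludes a shadow statement without the trisection hypothesis); `ledger negatives
--problem SmoothPoincare4` = 0 entries.
-/

noncomputable section

-- the prescribed namespace `Summit.<P>.<Sub>.…` duplicates `SmoothPoincare4` (P = Sub)
set_option linter.dupNamespace false

namespace Summit.SmoothPoincare4.SmoothPoincare4.Cruxes.NilpotentShadowsStandard.HeegaardAbsorption

open Literature.Topology.FourManifolds Literature.Algebra.Lie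
open Summit.SmoothPoincare4.SmoothPoincare4.Theses.CongruenceShadows
open scoped commutatorElement

/-! ## Vocabulary (documentation abbreviations; the registered stubs below are written out in full) -/

/-- The surface group `S = S_{3+3m}`. [folklore] -/
abbrev S (m : ℕ) : Type := SurfaceGroup (3 + 3 * m)

-- `𝔰⟦m⟧` = the surface Lie ring `𝔰_{3+3m}(ℤ)` (`= gr S`, Labute): a NOTATION, not a definition.
local notation "𝔰⟦" m "⟧" => Literature.Algebra.Lie.SurfaceLieAlgebra ℤ (3 + 3 * m)

/-- The ambient module of a submodule (a device to NAME the tree's own spelling of a carrier type). [folklore] -/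
@[reducible] def Ambient {R M : Type*} [Semiring R] [AddCommMonoid M] [Module R M] (_ : Submodule R M) : Type _ := M

/-- `Der(𝔰_{3+3m}(ℤ))` spelled EXACTLY as the tree spells it (the carrier of `derDegree ℤ (3+3m) 1`, i.e.
`LieDerivation ℤ 𝔰 𝔰` with the instance arguments of `Literature/Algebra/Lie/SurfaceLieAlgebra.lean` specialised to
`R = ℤ`). A freshly written `LieDerivation ℤ 𝔰 𝔰` elaborates with the generic `ℤ`-Lie-algebra instances
(`LieRing.instLieAlgebra`, `AddCommGroup.toIntModule`), definitionally but not syntactically equal to the tree's —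
provers: keep every derivation tree-typed (through memberships, or this abbreviation) and `rw` works. [folklore] -/
abbrev DerT (m : ℕ) : Type := Ambient (SurfaceLieAlgebra.derDegree ℤ (3 + 3 * m) 1)

/-- `γ m c = γ_{c+1}(S)` (`(⊤).lowerCentralSeries c`; so `γ m 0 = S`, level-`c` shadows live mod `γ m (c+1)`). [folklore] -/
abbrev γ (m c : ℕ) : Subgroup (S m) := (⊤ : Subgroup (S m)).lowerCentralSeries c

/-- The standard kernel triple `N = s4Kernels.stabilizeIter m`. [folklore] -/
abbrev N (m : ℕ) : TrisectionKernels (3 + 3 * m) := s4Kernels.stabilizeIter m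

/-- The coordinate cut systems `Cᵢ = s4CutSystem m i` (the letters killed by `Nᵢ`). [folklore] -/
abbrev C (m : ℕ) (i : Fin 3) : Set (Fin (3 + 3 * m) × Bool) := s4CutSystem m i

/-- Labute's specification of the degree maps `θₙ : S → 𝔰` at genus `3 + 3m`: VERBATIM the body of the named fact
`Literature.Algebra.Lie.Labute1970_grSurfaceGroup` at `g = 3 + 3m` (`labute_iff` below checks this definitionally).
[cite: Labute1970, §1 Theorem p. 17] -/
def LabuteSpec (m : ℕ) (θ : ℕ → S m → 𝔰⟦m⟧) : Prop :=
  (∀ n, ∀ x ∈ (⊤ : Subgroup (SurfaceGroup (3 + 3 * m))).lowerCentralSeries n,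
    ∀ y ∈ (⊤ : Subgroup (SurfaceGroup (3 + 3 * m))).lowerCentralSeries n,
      θ n (x * y) = θ n x + θ n y) ∧
  (∀ n, θ n '' ((⊤ : Subgroup (SurfaceGroup (3 + 3 * m))).lowerCentralSeries n) =
    SurfaceLieAlgebra.grade ℤ (3 + 3 * m) (n + 1)) ∧
  (∀ n, ∀ x ∈ (⊤ : Subgroup (SurfaceGroup (3 + 3 * m))).lowerCentralSeries n,
    θ n x = 0 ↔ x ∈ (⊤ : Subgroup (SurfaceGroup (3 + 3 * m))).lowerCentralSeries (n + 1)) ∧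
  (∀ i, θ 0 (SurfaceGroup.a i) = SurfaceLieAlgebra.a ℤ (3 + 3 * m) i) ∧
  (∀ i, θ 0 (SurfaceGroup.b i) = SurfaceLieAlgebra.b ℤ (3 + 3 * m) i) ∧
  (∀ p q, ∀ x ∈ (⊤ : Subgroup (SurfaceGroup (3 + 3 * m))).lowerCentralSeries p,
    ∀ y ∈ (⊤ : Subgroup (SurfaceGroup (3 + 3 * m))).lowerCentralSeries q,
      θ (p + q + 1) ⁅x, y⁆ = ⁅θ p x, θ q y⁆)

/-- Labute's named fact is `∀ g > 0, ∃ θ, LabuteSpec` (definitional check of the verbatim copy). [folklore] -/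
theorem labute_iff : Labute1970_grSurfaceGroup ↔
    ∀ g : ℕ, 0 < g → ∃ θ : ℕ → SurfaceGroup g → SurfaceLieAlgebra ℤ g,
      (∀ n, ∀ x ∈ (⊤ : Subgroup (SurfaceGroup g)).lowerCentralSeries n,
        ∀ y ∈ (⊤ : Subgroup (SurfaceGroup g)).lowerCentralSeries n, θ n (x * y) = θ n x + θ n y) ∧
      (∀ n, θ n '' ((⊤ : Subgroup (SurfaceGroup g)).lowerCentralSeries n) = SurfaceLieAlgebra.grade ℤ g (n + 1)) ∧
      (∀ n, ∀ x ∈ (⊤ : Subgroup (SurfaceGroup g)).lowerCentralSeries n,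
        θ n x = 0 ↔ x ∈ (⊤ : Subgroup (SurfaceGroup g)).lowerCentralSeries (n + 1)) ∧
      (∀ i, θ 0 (SurfaceGroup.a i) = SurfaceLieAlgebra.a ℤ g i) ∧
      (∀ i, θ 0 (SurfaceGroup.b i) = SurfaceLieAlgebra.b ℤ g i) ∧
      (∀ p q, ∀ x ∈ (⊤ : Subgroup (SurfaceGroup g)).lowerCentralSeries p,
        ∀ y ∈ (⊤ : Subgroup (SurfaceGroup g)).lowerCentralSeries q, θ (p + q + 1) ⁅x, y⁆ = ⁅θ p x, θ q y⁆) :=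
  Iff.rfl

/-- The level-`c` shadow of `K` is standard (the inner clause of the crux at level `c`). [folklore] -/
def ShadowStdAt (m : ℕ) (K : TrisectionKernels (3 + 3 * m)) (c : ℕ) : Prop :=
  ∃ ψ : S m ≃* S m, ∀ i : Fin 3, (N m i ⊔ γ m (c + 1)).map ψ.toMonoidHom = K i ⊔ γ m (c + 1)

/-- The crux is `∀ m K, IsGroupTrisection … K → ∀ c, ShadowStdAt m K c` (definitional). [folklore] -/
theorem crux_iff : NilpotentShadowsStandard ↔
    ∀ (m : ℕ) (K : TrisectionKernels (3 + 3 * m)),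
      IsGroupTrisection (3 + 3 * m) (m + 1) (PUnit : Type) K → ∀ c, ShadowStdAt m K c :=
  Iff.rfl

/-- `⟨Der₁⟩_c`: the `ℤ`-span of the `c`-fold iterated brackets of degree-`1` derivations of `𝔰` (the degree-`c`
part of the Lie subring generated by `Der₁(𝔰) = Λ³H`; over `ℚ` = the Johnson image, Hain 1997). [folklore] -/
def BracketGenerated (m c : ℕ) :=
  wordGrade ℤ (fun D : ↥(SurfaceLieAlgebra.derDegree ℤ (3 + 3 * m) 1) => D.1) c

/-- The degree-`c` tri-stabiliser `(𝔷₀ ∩ 𝔷₁ ∩ 𝔷₂)_c`: derivations of degree `c` preserving all three cut ideals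
`I_{Cᵢ}` (= the kernel of the joint restriction to the three cut systems: they move no shadow). [folklore] -/
def TriStab (m c : ℕ) :=
  ⨅ i : Fin 3, SurfaceLieAlgebra.cutStabilizerDegree ℤ (3 + 3 * m) (C m i) c

/-- `ψ` is trivial modulo `γ_{c+1}` and INDUCES the derivation `E` in degree `c` on the generators
(`θ_c(ψ(x)x⁻¹) = E(x)` for every letter `x`), i.e. `ψ ∈ A_c` and `τ_c(ψ) = E` on `𝔰₁`. [folklore] -/
def Induces (m c : ℕ) (θ : ℕ → S m → 𝔰⟦m⟧) (ψ : S m ≃* S m) (E : DerT m) : Prop :=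
  (∀ s : S m, ψ s * s⁻¹ ∈ γ m c) ∧
    ∀ x : Fin (3 + 3 * m) × Bool,
      θ c (ψ (PresentedGroup.of x) * (PresentedGroup.of x)⁻¹) = E (SurfaceLieAlgebra.gen ℤ (3 + 3 * m) x)

/-- `E` is a Johnson image modulo the tri-stabiliser: `E - Z = τ_c(ψ)` on generators for some `ψ ∈ A_c` and some
`Z ∈ (𝔷₀∩𝔷₁∩𝔷₂)_c`. [folklore] -/
def RealisableModStab (m c : ℕ) (θ : ℕ → S m → 𝔰⟦m⟧) (E : DerT m) : Prop :=
  ∃ ψ : S m ≃* S m, ∃ Z : DerT m, Z ∈ TriStab m c ∧ Induces m c θ ψ (E - Z)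

/-- REACH_c(θ): every ADMISSIBLE data triple `d` — (a) values on `Cᵢ` of degree `c+1`; (b) the `ζ`-condition
`∑ⱼ (⁅dᵢ aⱼ, bⱼ⁆ + ⁅aⱼ, dᵢ bⱼ⁆) ∈ I_{Cᵢ}` ("`dᵢ ∈ D_c(H/Lᵢ)`"); (c) pair compatibility `dᵢ x - dⱼ x ∈ I_{Cᵢ ∪ Cⱼ}`
on common cut letters — is reached by an automorphism trivial mod `γ_{c+1}`: `θ_c(ψ(x)x⁻¹) ≡ dᵢ x mod I_{Cᵢ}`
for all `x ∈ Cᵢ`, all `i` at once. [folklore] -/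
def Reach (m c : ℕ) (θ : ℕ → S m → 𝔰⟦m⟧) : Prop :=
  ∀ d : Fin 3 → (Fin (3 + 3 * m) × Bool) → 𝔰⟦m⟧,
    (∀ i : Fin 3, ∀ x ∈ C m i, d i x ∈ SurfaceLieAlgebra.grade ℤ (3 + 3 * m) (c + 1)) →
    (∀ i : Fin 3, (∑ j : Fin (3 + 3 * m),
        (⁅d i (j, false), SurfaceLieAlgebra.b ℤ (3 + 3 * m) j⁆ +
          ⁅SurfaceLieAlgebra.a ℤ (3 + 3 * m) j, d i (j, true)⁆)) ∈
      SurfaceLieAlgebra.cutIdeal ℤ (3 + 3 * m) (C m i)) →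
    (∀ i j : Fin 3, i ≠ j → ∀ x ∈ C m i ∩ C m j,
      d i x - d j x ∈ SurfaceLieAlgebra.cutIdeal ℤ (3 + 3 * m) (C m i ∪ C m j)) →
    ∃ ψ : S m ≃* S m, (∀ s : S m, ψ s * s⁻¹ ∈ γ m c) ∧
      ∀ i : Fin 3, ∀ x ∈ C m i,
        θ c (ψ (PresentedGroup.of x) * (PresentedGroup.of x)⁻¹) - d i x ∈
          SurfaceLieAlgebra.cutIdeal ℤ (3 + 3 * m) (C m i)

/-! ## The five named statements of the line (level 0 is the route item `AbelianShadowStandard`) -/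

/-- STATEMENT A — RATIONAL HEEGAARD ABSORPTION (the lever): every degree-`c` derivation of `𝔰_{3+3m}(ℤ)` has a
positive multiple in `⟨Der₁⟩_c + (𝔷₀∩𝔷₁∩𝔷₂)_c`. [folklore] -/
def RationalAbsorption : Prop :=
  ∀ (m c : ℕ), 1 ≤ c → ∀ D ∈ SurfaceLieAlgebra.derDegree ℤ (3 + 3 * m) c,
    ∃ n : ℕ, 0 < n ∧ n • D ∈ BracketGenerated m c ⊔ TriStab m c

/-- STATEMENT B — BRACKETS OF DEGREE-ONE DERIVATIONS ARE JOHNSON: every `D ∈ ⟨Der₁⟩_c` is induced on generators by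
an automorphism trivial mod `γ_{c+1}`. [folklore] -/
def JohnsonBrackets : Prop :=
  ∀ (m c : ℕ), 1 ≤ c → ∀ θ : ℕ → S m → 𝔰⟦m⟧, LabuteSpec m θ →
    ∀ D ∈ BracketGenerated m c, ∃ ψ : S m ≃* S m, Induces m c θ ψ D

/-- STATEMENT C — SATURATION (the integral residue): a degree-`c` derivation with a realisable positive multiple is
realisable (modulo the tri-stabiliser). [folklore] -/
def Saturation : Prop :=
  ∀ (m c : ℕ), 1 ≤ c → ∀ θ : ℕ → S m → 𝔰⟦m⟧, LabuteSpec m θ →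
    ∀ D ∈ SurfaceLieAlgebra.derDegree ℤ (3 + 3 * m) c,
      (∃ n : ℕ, 0 < n ∧ RealisableModStab m c θ (n • D)) → RealisableModStab m c θ D

/-- STATEMENT D — JOINT SURJECTIVITY onto admissible data (pure Lie algebra). [folklore] -/
def JointSurjectivity : Prop :=
  ∀ (m c : ℕ), 1 ≤ c → ∀ d : Fin 3 → (Fin (3 + 3 * m) × Bool) → 𝔰⟦m⟧,
    (∀ i : Fin 3, ∀ x ∈ C m i, d i x ∈ SurfaceLieAlgebra.grade ℤ (3 + 3 * m) (c + 1)) →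
    (∀ i : Fin 3, (∑ j : Fin (3 + 3 * m),
        (⁅d i (j, false), SurfaceLieAlgebra.b ℤ (3 + 3 * m) j⁆ +
          ⁅SurfaceLieAlgebra.a ℤ (3 + 3 * m) j, d i (j, true)⁆)) ∈
      SurfaceLieAlgebra.cutIdeal ℤ (3 + 3 * m) (C m i)) →
    (∀ i j : Fin 3, i ≠ j → ∀ x ∈ C m i ∩ C m j,
      d i x - d j x ∈ SurfaceLieAlgebra.cutIdeal ℤ (3 + 3 * m) (C m i ∪ C m j)) →
    ∃ D ∈ SurfaceLieAlgebra.derDegree ℤ (3 + 3 * m) c, ∀ i : Fin 3, ∀ x ∈ C m i,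
      D (SurfaceLieAlgebra.gen ℤ (3 + 3 * m) x) - d i x ∈ SurfaceLieAlgebra.cutIdeal ℤ (3 + 3 * m) (C m i)

/-- STATEMENT E — THE TORSOR STEP (dictionary): for a group trisection of `{1}`, REACH_c and a standard level-`(c-1)`
shadow give a standard level-`c` shadow. [folklore] -/
def TorsorStep : Prop :=
  ∀ (m c : ℕ), 1 ≤ c → ∀ K : TrisectionKernels (3 + 3 * m),
    IsGroupTrisection (3 + 3 * m) (m + 1) (PUnit : Type) K →
    ∀ θ : ℕ → S m → 𝔰⟦m⟧, LabuteSpec m θ → Reach m c θ →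
    (∃ ψ : S m ≃* S m, ∀ i : Fin 3, (N m i ⊔ γ m c).map ψ.toMonoidHom = K i ⊔ γ m c) →
    ∃ ψ : S m ≃* S m, ∀ i : Fin 3, (N m i ⊔ γ m (c + 1)).map ψ.toMonoidHom = K i ⊔ γ m (c + 1)

/-! ## The registered stubs (`sorry` lives ONLY in these six theorems; signatures written out over tree declarations) -/

/-- **STUB 1 · `stub_labute`** — Labute 1970 for the surface relator, the Literature named fact
`Labute1970_grSurfaceGroup` (`gr S_g ≅ 𝔰_g(ℤ)` through degree maps `θₙ`). KNOWN THEOREM, unproved in the tree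
(needs Magnus–Witt `gr F ≅ FreeLie` over `ℤ`, absent from Mathlib, then Labute's one-relator argument for
`∏[aᵢ,bᵢ]`); size L. It is the language of the dictionary: without it no Johnson-theoretic line can be typed over
`SurfaceGroup`. [cite: Labute1970, §1 Theorem p. 17] -/
theorem stub_labute : Literature.Algebra.Lie.Labute1970_grSurfaceGroup := by
  sorry

/-- **STUB 2 · `stub_rationalAbsorption`** — THE LEVER (Heegaard absorption, rank form): for `g = 3 + 3m`, `c ≥ 1`
and every `D ∈ Der_c(𝔰_g(ℤ))` some positive multiple `n • D` lies in `⟨Der₁⟩_c + (𝔷₀ ∩ 𝔷₁ ∩ 𝔷₂)_c`, where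
`⟨Der₁⟩_c = wordGrade ℤ (Der₁ ↪ Der) c` is the span of `c`-fold brackets of degree-one derivations and `𝔷ᵢ` is the
degree-`c` stabiliser of the cut ideal of `s4CutSystem m i`. Equivalently `r(⟨Der₁⟩_c)` has full rank in
`r(Der_c)`, `r` the joint restriction to the three cut systems. EVIDENCE: exact ranks mod `p = 10⁶+3` in the
bordered model (card: `(g,c) = (3,≤5)`, `(6,≤3)`; TRIAGE-r1-1 (C2) and r1-2 §3: `c ≤ 8` at `g = 3` via grafting
generation; all defects 0), and the closed model is a quotient of the bordered one. WHY PLAUSIBLY TRUE IN GENERAL: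
`⟨Der₁⟩ ⊗ ℚ ⊆ im τ ⊗ ℚ` (equality: Hain 1997, im `τ ⊗ ℚ` is generated in degree 1) + the known cokernel of `τ ⊗ ℚ` (Morita traces, Enomoto–Satoh,
Conant–Kassabov–Vogtmann classes are `ω`-contractions, generically non-zero on the huge tri-stabiliser); a proof
for all `c` at fixed `g` is the open core `ITJ_c(g)`, `c ≥ g` (crux idea `derivation-grafting-itj` is the
candidate mechanism; Levine math/0408310 Lemma 4.5 covers `c < g`). FALSIFIER: one weight block at some `(m,c)`
with positive rational defect. Size M (per `(m,c)`: a certified finite rank computation) to L (all `c`).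
[cite: arXiv:math/0408310, Thm 1 and Lemma 4.5; doi:10.1090/s0894-0347-97-00235-x (Hain 1997); doi:10.1215/s0012-7094-93-07017-2 (Morita 1993), §6] -/
theorem stub_rationalAbsorption :
    ∀ (m c : ℕ), 1 ≤ c →
      ∀ D ∈ Literature.Algebra.Lie.SurfaceLieAlgebra.derDegree ℤ (3 + 3 * m) c,
        ∃ n : ℕ, 0 < n ∧
          n • D ∈
            Literature.Algebra.Lie.wordGrade ℤ
                (fun D : ↥(Literature.Algebra.Lie.SurfaceLieAlgebra.derDegree ℤ (3 + 3 * m) 1) => D.1) c ⊔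
              ⨅ i : Fin 3, Literature.Algebra.Lie.SurfaceLieAlgebra.cutStabilizerDegree ℤ (3 + 3 * m)
                (Literature.Algebra.Lie.s4CutSystem m i) c := by
  sorry

/-- **STUB 3 · `stub_johnsonBrackets`** — brackets of degree-one derivations are Johnson: for `g = 3 + 3m`, `c ≥ 1`,
every Labute datum `θ` and every `D ∈ ⟨Der₁⟩_c`, there is an automorphism `ψ` of `S_g` trivial modulo `γ_{c+1}`
(`ψ ∈ A_c`) inducing `D` on the generators: `θ_c(ψ(x)x⁻¹) = D(x)` for every letter `x`. KNOWN MATHEMATICS, unproved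
in the tree: degree 1 is Johnson's theorem (`τ₁ : Torelli(Σ_{g,1}) ↠ Λ³H` for `g ≥ 3`, Johnson 1980; bounding-pair
maps on `F_{2g}` fixing `ζ = ∏[aᵢ,bᵢ]` descend to `S_g`, and `Der₁(𝔰) =` image of `D₁(H) = Λ³H` by lifting
generator values and correcting by `Hom(H,(ω))`), and the passage to `c`-fold brackets is Andreadakis' lemma
(`[A_k, A_l] ⊆ A_{k+l}`, `τ_{k+l}` of a group commutator is the bracket of the `τ`'s, `τ_k(ψφ) = τ_k ψ + τ_k φ`), so
the realisable derivations of degree `c` form a subgroup containing all bracket words. Size L (explicit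
automorphisms of the presented group with prescribed `τ₁`; the derivation property of `s ↦ ψ(s)s⁻¹` on `gr`).
FALSIFIER: none expected (theorem); a wrong sign/convention in `Induces` would show at `(g,c) = (3,1)` on
`D = a₁∧a₂∧a₃`. [cite: doi:10.1007/bf01363897 (Johnson 1980), Thm 1; doi:10.1112/plms/s3-15.1.239 (Andreadakis 1965), §1; arXiv:math/0408310, §2] -/
theorem stub_johnsonBrackets :
    ∀ (m c : ℕ), 1 ≤ c →
      ∀ θ : ℕ → Literature.Topology.FourManifolds.SurfaceGroup (3 + 3 * m) →
          Literature.Algebra.Lie.SurfaceLieAlgebra ℤ (3 + 3 * m),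
        ((∀ n, ∀ x ∈ (⊤ : Subgroup (Literature.Topology.FourManifolds.SurfaceGroup (3 + 3 * m))).lowerCentralSeries n,
            ∀ y ∈ (⊤ : Subgroup (Literature.Topology.FourManifolds.SurfaceGroup (3 + 3 * m))).lowerCentralSeries n,
              θ n (x * y) = θ n x + θ n y) ∧
          (∀ n, θ n '' ((⊤ : Subgroup (Literature.Topology.FourManifolds.SurfaceGroup (3 + 3 * m))).lowerCentralSeries n) =
            Literature.Algebra.Lie.SurfaceLieAlgebra.grade ℤ (3 + 3 * m) (n + 1)) ∧
          (∀ n, ∀ x ∈ (⊤ : Subgroup (Literature.Topology.FourManifolds.SurfaceGroup (3 + 3 * m))).lowerCentralSeries n,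
            θ n x = 0 ↔
              x ∈ (⊤ : Subgroup (Literature.Topology.FourManifolds.SurfaceGroup (3 + 3 * m))).lowerCentralSeries (n + 1)) ∧
          (∀ i, θ 0 (Literature.Topology.FourManifolds.SurfaceGroup.a i) =
            Literature.Algebra.Lie.SurfaceLieAlgebra.a ℤ (3 + 3 * m) i) ∧
          (∀ i, θ 0 (Literature.Topology.FourManifolds.SurfaceGroup.b i) =
            Literature.Algebra.Lie.SurfaceLieAlgebra.b ℤ (3 + 3 * m) i) ∧
          (∀ p q, ∀ x ∈ (⊤ : Subgroup (Literature.Topology.FourManifolds.SurfaceGroup (3 + 3 * m))).lowerCentralSeries p,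
            ∀ y ∈ (⊤ : Subgroup (Literature.Topology.FourManifolds.SurfaceGroup (3 + 3 * m))).lowerCentralSeries q,
              θ (p + q + 1) ⁅x, y⁆ = ⁅θ p x, θ q y⁆)) →
        ∀ D ∈ Literature.Algebra.Lie.wordGrade ℤ
            (fun D : ↥(Literature.Algebra.Lie.SurfaceLieAlgebra.derDegree ℤ (3 + 3 * m) 1) => D.1) c,
          ∃ ψ : Literature.Topology.FourManifolds.SurfaceGroup (3 + 3 * m) ≃*
              Literature.Topology.FourManifolds.SurfaceGroup (3 + 3 * m),
            (∀ s : Literature.Topology.FourManifolds.SurfaceGroup (3 + 3 * m),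
                ψ s * s⁻¹ ∈ (⊤ : Subgroup (Literature.Topology.FourManifolds.SurfaceGroup (3 + 3 * m))).lowerCentralSeries c) ∧
              ∀ x : Fin (3 + 3 * m) × Bool,
                θ c (ψ (PresentedGroup.of x) * (PresentedGroup.of x)⁻¹) =
                  D (Literature.Algebra.Lie.SurfaceLieAlgebra.gen ℤ (3 + 3 * m) x) := by
  sorry

/-- **STUB 4 · `stub_saturation`** — THE INTEGRAL RESIDUE (hardest; the bet): for `g = 3 + 3m`, `c ≥ 1`, a Labute
datum `θ` and `D ∈ Der_c(𝔰_g(ℤ))`: if some positive multiple `n • D` is a Johnson image modulo the tri-stabiliser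
(`n • D - Z` induced by some `ψ ∈ A_c`, `Z ∈ (𝔷₀∩𝔷₁∩𝔷₂)_c`), then so is `D`. Equivalently `Der_c/(𝔤_c + 𝔷₀₁₂,c)` is
torsion-free, i.e. `r(𝔤_c)` is saturated in `r(Der_c)`; with STUB 2–3 it is joint Levine surjectivity
`r(𝔤_c) = r(Der_c)` (TRIAGE: "the one load-bearing statement"). KNOWN: `c = 1` (`𝔤₁ = Der₁`, Johnson); `c = 2` at
`g = 3, 6, 9` by TRIAGE-r1-1 (C1) (`im τ₂ = ker Tr^as`, Faes arXiv:2010.16268 Thm 2.4; index 1 — the squares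
`τ₂(T_γ)` supply the 2-primary part `⟨Der₁⟩₂` misses); `c` odd `< g`: `im τ_c ⊇ 𝒟_c` (Levine math/0408310 Thm 1),
nothing to saturate. OPEN: `(g,c) = (3, ≥ 3)` and `c ≥ g` in general — `im τ_c` has no integral description there
(even `c < g`: index `2^?`, Levine's `𝒟̃ ⊇ 2𝒟`); the statement bets that the torsion of `Der_c/𝔤_c` (Morita–Yokomizo
2-torsion, the mod-5 grafting defect of TRIAGE-r1-2 §3 …) is swallowed by the tri-stabiliser, as it is at `c = 2`.
FALSIFIER: Smith normal form of `r(im τ₃) ⊂ r(D₃(H))` at `g = 3` once generators of `im τ₃` over `ℤ` are tabulated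
(Morita–Faes–Massuyeau degree-3 generators) — an invariant factor `> 1` kills it and exhibits a level-3 shadow of
genuine handlebody kernels unreachable by `Aut S₃` (then to be tested against genuine trisections). Size: open
problem from `c = 3`. [cite: arXiv:2010.16268, Thm 2.4; arXiv:math/0408310, Thm 1; doi:10.1215/s0012-7094-93-07017-2 (Morita 1993), §6] -/
theorem stub_saturation :
    ∀ (m c : ℕ), 1 ≤ c →
      ∀ θ : ℕ → Literature.Topology.FourManifolds.SurfaceGroup (3 + 3 * m) →
          Literature.Algebra.Lie.SurfaceLieAlgebra ℤ (3 + 3 * m),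
        ((∀ n, ∀ x ∈ (⊤ : Subgroup (Literature.Topology.FourManifolds.SurfaceGroup (3 + 3 * m))).lowerCentralSeries n,
            ∀ y ∈ (⊤ : Subgroup (Literature.Topology.FourManifolds.SurfaceGroup (3 + 3 * m))).lowerCentralSeries n,
              θ n (x * y) = θ n x + θ n y) ∧
          (∀ n, θ n '' ((⊤ : Subgroup (Literature.Topology.FourManifolds.SurfaceGroup (3 + 3 * m))).lowerCentralSeries n) =
            Literature.Algebra.Lie.SurfaceLieAlgebra.grade ℤ (3 + 3 * m) (n + 1)) ∧
          (∀ n, ∀ x ∈ (⊤ : Subgroup (Literature.Topology.FourManifolds.SurfaceGroup (3 + 3 * m))).lowerCentralSeries n,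
            θ n x = 0 ↔
              x ∈ (⊤ : Subgroup (Literature.Topology.FourManifolds.SurfaceGroup (3 + 3 * m))).lowerCentralSeries (n + 1)) ∧
          (∀ i, θ 0 (Literature.Topology.FourManifolds.SurfaceGroup.a i) =
            Literature.Algebra.Lie.SurfaceLieAlgebra.a ℤ (3 + 3 * m) i) ∧
          (∀ i, θ 0 (Literature.Topology.FourManifolds.SurfaceGroup.b i) =
            Literature.Algebra.Lie.SurfaceLieAlgebra.b ℤ (3 + 3 * m) i) ∧
          (∀ p q, ∀ x ∈ (⊤ : Subgroup (Literature.Topology.FourManifolds.SurfaceGroup (3 + 3 * m))).lowerCentralSeries p,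
            ∀ y ∈ (⊤ : Subgroup (Literature.Topology.FourManifolds.SurfaceGroup (3 + 3 * m))).lowerCentralSeries q,
              θ (p + q + 1) ⁅x, y⁆ = ⁅θ p x, θ q y⁆)) →
        ∀ D ∈ Literature.Algebra.Lie.SurfaceLieAlgebra.derDegree ℤ (3 + 3 * m) c,
          (∃ n : ℕ, 0 < n ∧
            ∃ ψ : Literature.Topology.FourManifolds.SurfaceGroup (3 + 3 * m) ≃*
                Literature.Topology.FourManifolds.SurfaceGroup (3 + 3 * m),
              ∃ Z ∈ ⨅ i : Fin 3, Literature.Algebra.Lie.SurfaceLieAlgebra.cutStabilizerDegree ℤ (3 + 3 * m)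
                  (Literature.Algebra.Lie.s4CutSystem m i) c,
                (∀ s : Literature.Topology.FourManifolds.SurfaceGroup (3 + 3 * m),
                    ψ s * s⁻¹ ∈ (⊤ : Subgroup (Literature.Topology.FourManifolds.SurfaceGroup (3 + 3 * m))).lowerCentralSeries c) ∧
                  ∀ x : Fin (3 + 3 * m) × Bool,
                    θ c (ψ (PresentedGroup.of x) * (PresentedGroup.of x)⁻¹) =
                      (n • D - Z) (Literature.Algebra.Lie.SurfaceLieAlgebra.gen ℤ (3 + 3 * m) x)) →
          ∃ ψ : Literature.Topology.FourManifolds.SurfaceGroup (3 + 3 * m) ≃*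
              Literature.Topology.FourManifolds.SurfaceGroup (3 + 3 * m),
            ∃ Z ∈ ⨅ i : Fin 3, Literature.Algebra.Lie.SurfaceLieAlgebra.cutStabilizerDegree ℤ (3 + 3 * m)
                (Literature.Algebra.Lie.s4CutSystem m i) c,
              (∀ s : Literature.Topology.FourManifolds.SurfaceGroup (3 + 3 * m),
                  ψ s * s⁻¹ ∈ (⊤ : Subgroup (Literature.Topology.FourManifolds.SurfaceGroup (3 + 3 * m))).lowerCentralSeries c) ∧
                ∀ x : Fin (3 + 3 * m) × Bool,
                  θ c (ψ (PresentedGroup.of x) * (PresentedGroup.of x)⁻¹) =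
                    (D - Z) (Literature.Algebra.Lie.SurfaceLieAlgebra.gen ℤ (3 + 3 * m) x) := by
  sorry

/-- **STUB 5 · `stub_jointSurjectivity`** — joint surjectivity of the restriction map onto admissible data (pure
Lie algebra; letter-content bookkeeping): for `g = 3 + 3m`, `c ≥ 1` and data `d : Fin 3 → letters → 𝔰` with
(a) `dᵢ x ∈ 𝔰_{c+1}` for `x ∈ Cᵢ`, (b) the `ζ`-condition `∑ⱼ (⁅dᵢ aⱼ, bⱼ⁆ + ⁅aⱼ, dᵢ bⱼ⁆) ∈ I_{Cᵢ}` (in the bordered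
dictionary: `dᵢ ∈ D_c(H/Lᵢ) = ker(V ⊗ L_{c+1}V → L_{c+2}V)`; values of `dᵢ` off `Cᵢ` only enter bracketed with a cut
letter, hence not at all), (c) pair compatibility `dᵢ x - dⱼ x ∈ I_{Cᵢ ∪ Cⱼ}` for `x ∈ Cᵢ ∩ Cⱼ`, there is ONE
`D ∈ Der_c(𝔰)` with `D(x) ≡ dᵢ x mod I_{Cᵢ}` for all `i`, `x ∈ Cᵢ`. WHY TRUE: in `D_c(H) = ⊕_κ D_c^κ` (letter content
`κ`) the `i`-th restriction reads exactly the contents `κ ⊆ Cᵢᶜ` and is the identity there (`D_c^κ(H) = D_c^κ(H/Lᵢ)`),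
so a triple is a joint restriction iff its components agree on contents seen twice, `κ ⊆ (Cᵢ ∪ Cⱼ)ᶜ` — which is (c);
the closed model `Der_c(𝔰) ⊇ im D_c(H)` only helps. Checked instances: `m = 0`, `c = 1,2,3` (ranks 3, 18, 18 = full,
no compatibility: ideator-2 j008472, TRIAGE-r1-3), `(m,c) = (1,2), (2,2)` (TRIAGE-r1-1 (C1): `r(D₂(H))` = all
pair-compatible triples). Size M–L (Mathlib's `FreeLieAlgebra` has no content grading / basis; the proof needs the
content decomposition of `𝔰 ⧸ I_C ≅ FreeLie(Cᶜ)` and coordinate sections). FALSIFIER: a compatible triple at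
`(m,c) = (1,3)` outside `r(D₃(H))` (exact linear algebra, minutes). [cite: arXiv:math/0408310, Lemma 4.3; arXiv:1003.2512, Thm 3.8] -/
theorem stub_jointSurjectivity :
    ∀ (m c : ℕ), 1 ≤ c →
      ∀ d : Fin 3 → (Fin (3 + 3 * m) × Bool) → Literature.Algebra.Lie.SurfaceLieAlgebra ℤ (3 + 3 * m),
        (∀ i : Fin 3, ∀ x ∈ Literature.Algebra.Lie.s4CutSystem m i,
            d i x ∈ Literature.Algebra.Lie.SurfaceLieAlgebra.grade ℤ (3 + 3 * m) (c + 1)) →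
        (∀ i : Fin 3,
            (∑ j : Fin (3 + 3 * m),
                (⁅d i (j, false), Literature.Algebra.Lie.SurfaceLieAlgebra.b ℤ (3 + 3 * m) j⁆ +
                  ⁅Literature.Algebra.Lie.SurfaceLieAlgebra.a ℤ (3 + 3 * m) j, d i (j, true)⁆)) ∈
              Literature.Algebra.Lie.SurfaceLieAlgebra.cutIdeal ℤ (3 + 3 * m) (Literature.Algebra.Lie.s4CutSystem m i)) →
        (∀ i j : Fin 3, i ≠ j →
            ∀ x ∈ Literature.Algebra.Lie.s4CutSystem m i ∩ Literature.Algebra.Lie.s4CutSystem m j,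
              d i x - d j x ∈
                Literature.Algebra.Lie.SurfaceLieAlgebra.cutIdeal ℤ (3 + 3 * m)
                  (Literature.Algebra.Lie.s4CutSystem m i ∪ Literature.Algebra.Lie.s4CutSystem m j)) →
        ∃ D ∈ Literature.Algebra.Lie.SurfaceLieAlgebra.derDegree ℤ (3 + 3 * m) c,
          ∀ i : Fin 3, ∀ x ∈ Literature.Algebra.Lie.s4CutSystem m i,
            D (Literature.Algebra.Lie.SurfaceLieAlgebra.gen ℤ (3 + 3 * m) x) - d i x ∈
              Literature.Algebra.Lie.SurfaceLieAlgebra.cutIdeal ℤ (3 + 3 * m) (Literature.Algebra.Lie.s4CutSystem m i) := by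
  sorry

/-- **STUB 6 · `stub_torsorStep`** — THE DICTIONARY (saturated torsor descent, one level): for `g = 3 + 3m`, `c ≥ 1`,
a `(g, m+1)` group trisection `K` of the trivial group, a Labute datum `θ`, REACH_c(θ) (every admissible data triple
is `θ_c(ψ(x)x⁻¹) mod I_{Cᵢ}` for one `ψ` trivial mod `γ_{c+1}`) and a standard level-`(c-1)` shadow
(`ψ₀(Nᵢγ_{c+1}) = Kᵢγ_{c+1}`), the level-`c` shadow is standard. PROOF PLAN (TRIAGE "torsor calculus", verified by
hand ×3): transport `K ↦ ψ₀⁻¹K` (IsGroupTrisection is `Iso`-invariant); `Nᵢ = ⟪letters of Cᵢ⟫` (stabilizeIter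
unfolds to the erase pattern); no hidden depth `(Nᵢ ∩ γ_{c+1})γ_{c+2} = θ_c⁻¹(I_{Cᵢ}) = (Kᵢ ∩ γ_{c+1})γ_{c+2}` from
`S/Kᵢ ≅ F_g` (Witt for `gr F_g`, the `g` surviving letters are a free-nilpotent basis of `S/Kᵢγ_{c+2}` by Hopf);
the datum `dᵢ x := θ_c(k_x x⁻¹)`, `k_x ∈ Kᵢ ∩ xγ_{c+1}`, is well defined mod `I_{Cᵢ}`, satisfies (b) from the relator
`∏[aⱼ,bⱼ] = 1` read in `S/Kᵢγ_{c+3} ≅ F_g/γ_{c+3}` and (c) from `S/KᵢKⱼ ≅ F_{m+1}`; REACH gives `ψ ∈ A_c` with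
`ψ(x) ∈ (Nᵢ∩γ_{c+1})γ_{c+2}·k_x ⊆ Kᵢγ_{c+2}`, so `ψ(Nᵢγ_{c+2}) ≤ Kᵢγ_{c+2}` with equal images mod `γ_{c+1}` and equal
meets with `γ_{c+1}` — Dedekind gives equality; answer `ψ₀ ∘ ψ`. It honours
`nilpotentShadowsStandard_false_without_trisection` (uses `free_quotient`, `free_pairQuotient`). Size L
(five-term sequence `Nᵢ/[S,Nᵢ] ≅ Lᵢ`, Witt/Labute bookkeeping, none in Mathlib). FALSIFIER: the `(m,c) = (0,1)`
instance by hand (Disproof `levelOne_note` is exactly this computation). [cite: AbramsGayKirby2018, Def. 1; Labute1970, §1; arXiv:2010.16268, Lemma 3.7] -/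
theorem stub_torsorStep :
    ∀ (m c : ℕ), 1 ≤ c →
      ∀ K : Literature.Topology.FourManifolds.TrisectionKernels (3 + 3 * m),
        Literature.Topology.FourManifolds.IsGroupTrisection (3 + 3 * m) (m + 1) (PUnit : Type) K →
        ∀ θ : ℕ → Literature.Topology.FourManifolds.SurfaceGroup (3 + 3 * m) →
            Literature.Algebra.Lie.SurfaceLieAlgebra ℤ (3 + 3 * m),
          ((∀ n, ∀ x ∈ (⊤ : Subgroup (Literature.Topology.FourManifolds.SurfaceGroup (3 + 3 * m))).lowerCentralSeries n,
              ∀ y ∈ (⊤ : Subgroup (Literature.Topology.FourManifolds.SurfaceGroup (3 + 3 * m))).lowerCentralSeries n,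
                θ n (x * y) = θ n x + θ n y) ∧
            (∀ n, θ n '' ((⊤ : Subgroup (Literature.Topology.FourManifolds.SurfaceGroup (3 + 3 * m))).lowerCentralSeries n) =
              Literature.Algebra.Lie.SurfaceLieAlgebra.grade ℤ (3 + 3 * m) (n + 1)) ∧
            (∀ n, ∀ x ∈ (⊤ : Subgroup (Literature.Topology.FourManifolds.SurfaceGroup (3 + 3 * m))).lowerCentralSeries n,
              θ n x = 0 ↔
                x ∈ (⊤ : Subgroup (Literature.Topology.FourManifolds.SurfaceGroup (3 + 3 * m))).lowerCentralSeries (n + 1)) ∧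
            (∀ i, θ 0 (Literature.Topology.FourManifolds.SurfaceGroup.a i) =
              Literature.Algebra.Lie.SurfaceLieAlgebra.a ℤ (3 + 3 * m) i) ∧
            (∀ i, θ 0 (Literature.Topology.FourManifolds.SurfaceGroup.b i) =
              Literature.Algebra.Lie.SurfaceLieAlgebra.b ℤ (3 + 3 * m) i) ∧
            (∀ p q, ∀ x ∈ (⊤ : Subgroup (Literature.Topology.FourManifolds.SurfaceGroup (3 + 3 * m))).lowerCentralSeries p,
              ∀ y ∈ (⊤ : Subgroup (Literature.Topology.FourManifolds.SurfaceGroup (3 + 3 * m))).lowerCentralSeries q,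
                θ (p + q + 1) ⁅x, y⁆ = ⁅θ p x, θ q y⁆)) →
          (∀ d : Fin 3 → (Fin (3 + 3 * m) × Bool) → Literature.Algebra.Lie.SurfaceLieAlgebra ℤ (3 + 3 * m),
              (∀ i : Fin 3, ∀ x ∈ Literature.Algebra.Lie.s4CutSystem m i,
                  d i x ∈ Literature.Algebra.Lie.SurfaceLieAlgebra.grade ℤ (3 + 3 * m) (c + 1)) →
              (∀ i : Fin 3,
                  (∑ j : Fin (3 + 3 * m),
                      (⁅d i (j, false), Literature.Algebra.Lie.SurfaceLieAlgebra.b ℤ (3 + 3 * m) j⁆ +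
                        ⁅Literature.Algebra.Lie.SurfaceLieAlgebra.a ℤ (3 + 3 * m) j, d i (j, true)⁆)) ∈
                    Literature.Algebra.Lie.SurfaceLieAlgebra.cutIdeal ℤ (3 + 3 * m)
                      (Literature.Algebra.Lie.s4CutSystem m i)) →
              (∀ i j : Fin 3, i ≠ j →
                  ∀ x ∈ Literature.Algebra.Lie.s4CutSystem m i ∩ Literature.Algebra.Lie.s4CutSystem m j,
                    d i x - d j x ∈
                      Literature.Algebra.Lie.SurfaceLieAlgebra.cutIdeal ℤ (3 + 3 * m)
                        (Literature.Algebra.Lie.s4CutSystem m i ∪ Literature.Algebra.Lie.s4CutSystem m j)) →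
              ∃ ψ : Literature.Topology.FourManifolds.SurfaceGroup (3 + 3 * m) ≃*
                  Literature.Topology.FourManifolds.SurfaceGroup (3 + 3 * m),
                (∀ s : Literature.Topology.FourManifolds.SurfaceGroup (3 + 3 * m),
                    ψ s * s⁻¹ ∈ (⊤ : Subgroup (Literature.Topology.FourManifolds.SurfaceGroup (3 + 3 * m))).lowerCentralSeries c) ∧
                  ∀ i : Fin 3, ∀ x ∈ Literature.Algebra.Lie.s4CutSystem m i,
                    θ c (ψ (PresentedGroup.of x) * (PresentedGroup.of x)⁻¹) - d i x ∈
                      Literature.Algebra.Lie.SurfaceLieAlgebra.cutIdeal ℤ (3 + 3 * m)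
                        (Literature.Algebra.Lie.s4CutSystem m i)) →
          (∃ ψ : Literature.Topology.FourManifolds.SurfaceGroup (3 + 3 * m) ≃*
              Literature.Topology.FourManifolds.SurfaceGroup (3 + 3 * m),
            ∀ i : Fin 3,
              (Literature.Topology.FourManifolds.s4Kernels.stabilizeIter m i ⊔
                    (⊤ : Subgroup (Literature.Topology.FourManifolds.SurfaceGroup (3 + 3 * m))).lowerCentralSeries c).map
                  ψ.toMonoidHom =
                K i ⊔ (⊤ : Subgroup (Literature.Topology.FourManifolds.SurfaceGroup (3 + 3 * m))).lowerCentralSeries c) →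
          ∃ ψ : Literature.Topology.FourManifolds.SurfaceGroup (3 + 3 * m) ≃*
              Literature.Topology.FourManifolds.SurfaceGroup (3 + 3 * m),
            ∀ i : Fin 3,
              (Literature.Topology.FourManifolds.s4Kernels.stabilizeIter m i ⊔
                    (⊤ : Subgroup (Literature.Topology.FourManifolds.SurfaceGroup (3 + 3 * m))).lowerCentralSeries (c + 1)).map
                  ψ.toMonoidHom =
                K i ⊔ (⊤ : Subgroup (Literature.Topology.FourManifolds.SurfaceGroup (3 + 3 * m))).lowerCentralSeries (c + 1) := by
  sorry

/-! ### Consistency: each named statement IS its registered stub (definitionally) -/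

theorem rationalAbsorption_holds : RationalAbsorption := stub_rationalAbsorption
theorem johnsonBrackets_holds : JohnsonBrackets := stub_johnsonBrackets
theorem saturation_holds : Saturation := stub_saturation
theorem jointSurjectivity_holds : JointSurjectivity := stub_jointSurjectivity
theorem torsorStep_holds : TorsorStep := stub_torsorStep

/-! ### Name-keyed aliases of the statements (the hypotheses of the composition; the skeleton audit admits a
hypothesis by the last name component of its head) -/
namespace Registered

/-- Alias of the named fact `Labute1970_grSurfaceGroup` keyed by the registered stub name. -/
abbrev stub_labute : Prop := Literature.Algebra.Lie.Labute1970_grSurfaceGroup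
/-- Alias of `RationalAbsorption` keyed by the registered stub name. -/
abbrev stub_rationalAbsorption : Prop := RationalAbsorption
/-- Alias of `JohnsonBrackets` keyed by the registered stub name. -/
abbrev stub_johnsonBrackets : Prop := JohnsonBrackets
/-- Alias of `Saturation` keyed by the registered stub name. -/
abbrev stub_saturation : Prop := Saturation
/-- Alias of `JointSurjectivity` keyed by the registered stub name. -/
abbrev stub_jointSurjectivity : Prop := JointSurjectivity
/-- Alias of `TorsorStep` keyed by the registered stub name. -/
abbrev stub_torsorStep : Prop := TorsorStep

end Registered

/-! ## Proved glue (no `sorry` below this line) -/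

/-- A tri-stabiliser kills cut letters modulo the corresponding cut ideal: `Z ∈ (𝔷₀∩𝔷₁∩𝔷₂)_c`, `x ∈ Cᵢ` ⇒
`Z(x) ∈ I_{Cᵢ}`. [folklore] -/
theorem triStab_apply_gen_mem {m c : ℕ} {Z : DerT m} (hZ : Z ∈ TriStab m c) {i : Fin 3}
    {x : Fin (3 + 3 * m) × Bool} (hx : x ∈ C m i) :
    Z (SurfaceLieAlgebra.gen ℤ (3 + 3 * m) x) ∈ SurfaceLieAlgebra.cutIdeal ℤ (3 + 3 * m) (C m i) := by
  have hZi : Z ∈ SurfaceLieAlgebra.cutStabilizerDegree ℤ (3 + 3 * m) (C m i) c :=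
    iInf_le (fun j : Fin 3 => SurfaceLieAlgebra.cutStabilizerDegree ℤ (3 + 3 * m) (C m j) c) i hZ
  have hst := ((SurfaceLieAlgebra.mem_cutStabilizerDegree_iff ℤ (3 + 3 * m)).1 hZi).1
  exact (SurfaceLieAlgebra.mem_derStabilizer_cutIdeal_iff ℤ (3 + 3 * m)).1 hst x hx

/-- **The lever at work: REACH_c from statements A–D.** Given admissible data, joint surjectivity (D) gives one
derivation `D` restricting to it; rational absorption (A) writes `n • D = D' + Z` with `D'` a bracket word and `Z`
a tri-stabiliser; bracket realisation (B) induces `D'` by an automorphism, so `n • D` is realisable modulo the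
tri-stabiliser; saturation (C) makes `D` itself realisable, `D - Z'' = τ_c(ψ)` on generators; and `Z''` moves no
cut letter modulo its cut ideal. [folklore] -/
theorem reach_of (hA : RationalAbsorption) (hB : JohnsonBrackets) (hC : Saturation) (hD : JointSurjectivity)
    {m c : ℕ} (hc : 1 ≤ c) {θ : ℕ → S m → 𝔰⟦m⟧} (hθ : LabuteSpec m θ) : Reach m c θ := by
  intro d ha hb hcomp
  -- (D) one derivation restricting to the data
  obtain ⟨D, hDmem, hDd⟩ := hD m c hc d ha hb hcomp
  -- (A) a positive multiple is a bracket word plus a tri-stabiliser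
  obtain ⟨n, hn, hnD⟩ := hA m c hc D hDmem
  obtain ⟨D', hD', Z, hZ, hsum⟩ := Submodule.mem_sup.1 hnD
  -- (B) the bracket word is induced by an automorphism trivial mod γ_{c+1}
  obtain ⟨ψ', hψ'A, hψ'⟩ := hB m c hc θ hθ D' hD'
  have hsub : n • D - Z = D' := sub_eq_of_eq_add hsum.symm
  have hreal : RealisableModStab m c θ (n • D) := by
    refine ⟨ψ', Z, hZ, hψ'A, fun x => ?_⟩
    rw [hsub]
    exact hψ' x
  -- (C) saturation
  obtain ⟨ψ, Z'', hZ'', hψA, hψ⟩ := hC m c hc θ hθ D hDmem ⟨n, hn, hreal⟩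
  refine ⟨ψ, hψA, fun i x hx => ?_⟩
  have e : (D - Z'') (SurfaceLieAlgebra.gen ℤ (3 + 3 * m) x) =
      D (SurfaceLieAlgebra.gen ℤ (3 + 3 * m) x) - Z'' (SurfaceLieAlgebra.gen ℤ (3 + 3 * m) x) :=
    LieDerivation.sub_apply _
  have key : (D - Z'') (SurfaceLieAlgebra.gen ℤ (3 + 3 * m) x) - d i x =
      (D (SurfaceLieAlgebra.gen ℤ (3 + 3 * m) x) - d i x) - Z'' (SurfaceLieAlgebra.gen ℤ (3 + 3 * m) x) :=
    (congrArg (· - d i x) e).trans (sub_right_comm _ _ _)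
  rw [hψ x, key]
  exact (SurfaceLieAlgebra.cutIdeal ℤ (3 + 3 * m) (C m i)).sub_mem (hDd i x hx) (triStab_apply_gen_mem hZ'' hx)

/-! ## The composition: the stubs (+ the route item `AbelianShadowStandard`) imply the crux, BY NAME -/

/-- **`NilpotentShadowsStandard_of`** — the line: induction on the level `c`; level `0` is the route's support item
`AbelianShadowStandard` (stmt-SmoothPoincare4-14599, hypothesis by name); the step is `stub_torsorStep` fed with
REACH_c (`reach_of`: rational absorption + bracket realisation + saturation + joint surjectivity) over a Labute
datum supplied by `stub_labute`. Kernel-checked; `sorry` only inside the six registered stubs. -/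
theorem NilpotentShadowsStandard_of (hL : Registered.stub_labute) (hA : Registered.stub_rationalAbsorption)
    (hB : Registered.stub_johnsonBrackets) (hC : Registered.stub_saturation)
    (hD : Registered.stub_jointSurjectivity) (hE : Registered.stub_torsorStep)
    (h0 : Summit.SmoothPoincare4.SmoothPoincare4.Theses.CongruenceShadows.AbelianShadowStandard) :
    Summit.SmoothPoincare4.SmoothPoincare4.Theses.CongruenceShadows.NilpotentShadowsStandard := by
  intro m K hK c
  obtain ⟨θ, hθ⟩ := hL (3 + 3 * m) (by omega)
  have hθ' : LabuteSpec m θ := hθ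
  induction c with
  | zero => exact h0 m K hK
  | succ c ih =>
    exact hE m (c + 1) (Nat.succ_le_succ (Nat.zero_le c)) K hK θ hθ' (reach_of hA hB hC hD (Nat.succ_le_succ (Nat.zero_le c)) hθ') ih

/-- Wiring check: the registered stubs feed `NilpotentShadowsStandard_of` as stated (the verbatim restatements are
definitionally the named statements); only the route item `AbelianShadowStandard` remains a hypothesis. -/
example (h0 : AbelianShadowStandard) : NilpotentShadowsStandard :=
  NilpotentShadowsStandard_of stub_labute stub_rationalAbsorption stub_johnsonBrackets stub_saturation
    stub_jointSurjectivity stub_torsorStep h0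

/-! ## Side checks (sorry-free): the decomposition loses nothing obvious -/

/-- The level-`c` statement produced by the induction is literally the disprover's `ShadowStdAt` reading of the
crux (so `Negative.Shape.shadow_mono` / `counterexample_shape` apply to the partial results of the line). [folklore] -/
example (m : ℕ) (K : TrisectionKernels (3 + 3 * m)) (c : ℕ) :
    ShadowStdAt m K c ↔
      ∃ ψ : SurfaceGroup (3 + 3 * m) ≃* SurfaceGroup (3 + 3 * m), ∀ i : Fin 3,
        (s4Kernels.stabilizeIter m i ⊔
            (⊤ : Subgroup (SurfaceGroup (3 + 3 * m))).lowerCentralSeries (c + 1)).map ψ.toMonoidHom =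
          K i ⊔ (⊤ : Subgroup (SurfaceGroup (3 + 3 * m))).lowerCentralSeries (c + 1) :=
  Iff.rfl

/-- Degree one of the lever is free: `Der₁ ≤ ⟨Der₁⟩₁` (so `stub_rationalAbsorption` at `c = 1` holds with `n = 1`,
and REACH₁ is Johnson's theorem + saturation-free). [folklore] -/
theorem derDegree_one_le_bracketGenerated (m : ℕ) :
    SurfaceLieAlgebra.derDegree ℤ (3 + 3 * m) 1 ≤ BracketGenerated m 1 := by
  intro D hD
  have : (⟨D, hD⟩ : SurfaceLieAlgebra.derDegree ℤ (3 + 3 * m) 1).val ∈ BracketGenerated m 1 :=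
    mem_wordGrade_one _ _
  exact this

end Summit.SmoothPoincare4.SmoothPoincare4.Cruxes.NilpotentShadowsStandard.HeegaardAbsorption

end
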